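import Literature.Analysis.Calculus.CutoffDataEnergy

/-!
# Crux `WindowedShellChannels` (stmt-FinalStateConjecture-14085), line `Sketch` — stub `stub_layerSplit`,
# part 3: energy of the four cut pieces and the pigeonhole over geometric layers

Support file for `stub_layerSplit σ` (everything proved, no definitions).  For a continuous
potential `V ≥ 0`, data `h ∈ C¹`, `g ∈ C⁰` with data energy density `e₀ = g² + h′² + Vh²`, and a
`C¹` partition of unity `χz + χn + χf + χg = 1` adapted to the open layer `{L < |x| < ΛL}`
(`0 ≤ χ•`, `χz + χn + χf ≤ 1`, `χz′² + χn′² + χf′² ≤ 16/x²`, `χg′² ≤ 16/x²`, all derivatives and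
`χg` vanishing off the layer — the cutoffs of part 2), the cut data `(χ• h, χ• g)` satisfy

* `∫⁻ e(χz) + ∫⁻ e(χn) + ∫⁻ e(χf) ≤ ∫⁻ e₀ + ∫⁻_{layer} F` (`lintegral_three_le`),
* `∫⁻ e(χg) ≤ ∫⁻_{layer} F` (`lintegral_gap_le`),

with the layer cost density `F = 2e₀ + 32 h²/x²` (pointwise: `e(χh, χg) ≤ χ²e₀ + 1_{χ′≠0}h′² + 2χ′²h²`).
For data vanishing on `[−ρ, ρ]` the two-sided Hardy bound `∫⁻ h²/x² ≤ 4∫⁻ h′²`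
(`Literature.Analysis.Calculus.lintegral_sq_div_sq_le_four_mul`) gives `∫⁻_ℝ F ≤ 130 ∫⁻ e₀`, and
since the `N` geometric layers `{RsΛ^j < |x| < RsΛ^{j+1}}`, `j < N`, are disjoint, one of them has
`N · ∫⁻_{layer j} F ≤ 130 ∫⁻ e₀` (`layerSplit_exists_cheap_layer`, the registered principal fact).
[folklore]
-/

noncomputable section

set_option linter.dupNamespace false

namespace Summit.FinalStateConjecture.FinalStateConjecture.Theorems.WindowedShellChannelsSketch

open Real Set MeasureTheory Filter Literature.Analysis.Calculus
open scoped ENNReal Topology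

namespace LayerSplit

/-! ### Pointwise densities -/

/-- **Three cut pieces, pointwise, in the layer**: with `0 ≤ c•`, `cz + cn + cf ≤ 1`,
`dz² + dn² + df² ≤ W`: `Σ e(c• h, c• g) ≤ e₀ + (h′² + 2W h²)`. [folklore] -/
theorem three_density_le {V g h h' cz cn cf dz dn df W : ℝ} (hV : 0 ≤ V)
    (hcz : 0 ≤ cz) (hcn : 0 ≤ cn) (hcf : 0 ≤ cf) (hsum : cz + cn + cf ≤ 1)
    (hd : dz ^ 2 + dn ^ 2 + df ^ 2 ≤ W) :
    ((cz * g) ^ 2 + (dz * h + cz * h') ^ 2 + V * (cz * h) ^ 2)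
      + ((cn * g) ^ 2 + (dn * h + cn * h') ^ 2 + V * (cn * h) ^ 2)
      + ((cf * g) ^ 2 + (df * h + cf * h') ^ 2 + V * (cf * h) ^ 2)
      ≤ (g ^ 2 + h' ^ 2 + V * h ^ 2) + (h' ^ 2 + 2 * W * h ^ 2) := by
  set S := cz ^ 2 + cn ^ 2 + cf ^ 2 with hS
  have hS1 : S ≤ 1 := by
    have hcz1 : cz ≤ 1 := by linarith
    have hcn1 : cn ≤ 1 := by linarith
    have hcf1 : cf ≤ 1 := by linarith
    rw [hS]; nlinarith
  have hmid : (dz * h + cz * h') ^ 2 + (dn * h + cn * h') ^ 2 + (df * h + cf * h') ^ 2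
      ≤ 2 * ((dz ^ 2 + dn ^ 2 + df ^ 2) * h ^ 2) + 2 * (S * h' ^ 2) := by
    rw [hS]
    nlinarith [sq_nonneg (dz * h - cz * h'), sq_nonneg (dn * h - cn * h'), sq_nonneg (df * h - cf * h')]
  have a1 : 0 ≤ (1 - S) * g ^ 2 := mul_nonneg (by linarith) (sq_nonneg _)
  have a2 : 0 ≤ (W - (dz ^ 2 + dn ^ 2 + df ^ 2)) * h ^ 2 := mul_nonneg (by linarith) (sq_nonneg _)
  have a3 : 0 ≤ (1 - S) * h' ^ 2 := mul_nonneg (by linarith) (sq_nonneg _)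
  have a4 : 0 ≤ V * ((1 - S) * h ^ 2) := mul_nonneg hV (mul_nonneg (by linarith) (sq_nonneg _))
  have e : ((cz * g) ^ 2 + (dz * h + cz * h') ^ 2 + V * (cz * h) ^ 2)
      + ((cn * g) ^ 2 + (dn * h + cn * h') ^ 2 + V * (cn * h) ^ 2)
      + ((cf * g) ^ 2 + (df * h + cf * h') ^ 2 + V * (cf * h) ^ 2)
      = S * g ^ 2 + ((dz * h + cz * h') ^ 2 + (dn * h + cn * h') ^ 2 + (df * h + cf * h') ^ 2)
        + V * (S * h ^ 2) := by rw [hS]; ring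
  rw [e]
  nlinarith [a1, a2, a3, a4, hmid]

/-- **Three cut pieces, pointwise, off the layer** (`dz = dn = df = 0`): `Σ e(c• h, c• g) ≤ e₀`.
[folklore] -/
theorem three_density_le_off {V g h h' cz cn cf : ℝ} (hV : 0 ≤ V)
    (hcz : 0 ≤ cz) (hcn : 0 ≤ cn) (hcf : 0 ≤ cf) (hsum : cz + cn + cf ≤ 1) :
    ((cz * g) ^ 2 + (0 * h + cz * h') ^ 2 + V * (cz * h) ^ 2)
      + ((cn * g) ^ 2 + (0 * h + cn * h') ^ 2 + V * (cn * h) ^ 2)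
      + ((cf * g) ^ 2 + (0 * h + cf * h') ^ 2 + V * (cf * h) ^ 2)
      ≤ g ^ 2 + h' ^ 2 + V * h ^ 2 := by
  set S := cz ^ 2 + cn ^ 2 + cf ^ 2 with hS
  have hS1 : S ≤ 1 := by
    have hcz1 : cz ≤ 1 := by linarith
    have hcn1 : cn ≤ 1 := by linarith
    have hcf1 : cf ≤ 1 := by linarith
    rw [hS]; nlinarith
  have a1 : 0 ≤ (1 - S) * g ^ 2 := mul_nonneg (by linarith) (sq_nonneg _)
  have a3 : 0 ≤ (1 - S) * h' ^ 2 := mul_nonneg (by linarith) (sq_nonneg _)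
  have a4 : 0 ≤ V * ((1 - S) * h ^ 2) := mul_nonneg hV (mul_nonneg (by linarith) (sq_nonneg _))
  have e : ((cz * g) ^ 2 + (0 * h + cz * h') ^ 2 + V * (cz * h) ^ 2)
      + ((cn * g) ^ 2 + (0 * h + cn * h') ^ 2 + V * (cn * h) ^ 2)
      + ((cf * g) ^ 2 + (0 * h + cf * h') ^ 2 + V * (cf * h) ^ 2)
      = S * g ^ 2 + S * h' ^ 2 + V * (S * h ^ 2) := by rw [hS]; ring
  rw [e]
  nlinarith [a1, a3, a4]

/-- **The gap piece, pointwise, in the layer**: `0 ≤ c ≤ 1`, `d² ≤ W`: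
`e(ch, cg) ≤ e₀ + (h′² + 2W h²)`. [folklore] -/
theorem gap_density_le {V g h h' c d W : ℝ} (hV : 0 ≤ V) (hc0 : 0 ≤ c) (hc1 : c ≤ 1)
    (hd : d ^ 2 ≤ W) :
    (c * g) ^ 2 + (d * h + c * h') ^ 2 + V * (c * h) ^ 2
      ≤ (g ^ 2 + h' ^ 2 + V * h ^ 2) + (h' ^ 2 + 2 * W * h ^ 2) := by
  have hc2 : c ^ 2 ≤ 1 := by nlinarith
  have hmid : (d * h + c * h') ^ 2 ≤ 2 * (d ^ 2 * h ^ 2) + 2 * (c ^ 2 * h' ^ 2) := by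
    nlinarith [sq_nonneg (d * h - c * h')]
  have a1 : 0 ≤ (1 - c ^ 2) * g ^ 2 := mul_nonneg (by linarith) (sq_nonneg _)
  have a2 : 0 ≤ (W - d ^ 2) * h ^ 2 := mul_nonneg (by linarith) (sq_nonneg _)
  have a3 : 0 ≤ (1 - c ^ 2) * h' ^ 2 := mul_nonneg (by linarith) (sq_nonneg _)
  have a4 : 0 ≤ V * ((1 - c ^ 2) * h ^ 2) := mul_nonneg hV (mul_nonneg (by linarith) (sq_nonneg _))
  have e : (c * g) ^ 2 + (d * h + c * h') ^ 2 + V * (c * h) ^ 2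
      = c ^ 2 * g ^ 2 + (d * h + c * h') ^ 2 + V * (c ^ 2 * h ^ 2) := by ring
  rw [e]
  nlinarith [a1, a2, a3, a4, hmid]

/-! ### Integrated bounds -/

section Integrated

variable {V h g : ℝ → ℝ} {L Λ : ℝ}

/-- The open layer `{L < |x| < ΛL}` is measurable. [folklore] -/
theorem measurableSet_layer (L M : ℝ) : MeasurableSet {x : ℝ | L < |x| ∧ |x| < M} :=
  (measurableSet_lt measurable_const continuous_abs.measurable).inter
    (measurableSet_lt continuous_abs.measurable measurable_const)

/-- The data energy density is measurable. [folklore] -/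
theorem measurable_dataDensity (hV : Continuous V) (hh : ContDiff ℝ 1 h) (hg : Continuous g) :
    Measurable fun x => ENNReal.ofReal (g x ^ 2 + deriv h x ^ 2 + V x * h x ^ 2) :=
  (((hg.pow 2).add ((hh.continuous_deriv le_rfl).pow 2)).add
    (hV.mul (hh.continuous.pow 2))).measurable.ennreal_ofReal

/-- **Energy of the three outer pieces**: `∫⁻ e(χz) + ∫⁻ e(χn) + ∫⁻ e(χf) ≤ ∫⁻ e₀ + ∫⁻_{layer} F`,
`F = 2e₀ + 32h²/x²`. [folklore] -/
theorem lintegral_three_le (hV : Continuous V) (hV0 : ∀ x, 0 ≤ V x) (hh : ContDiff ℝ 1 h)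
    (hg : Continuous g) {χz χn χf : ℝ → ℝ}
    (hχz : Differentiable ℝ χz) (hχn : Differentiable ℝ χn) (hχf : Differentiable ℝ χf)
    (h01 : ∀ x, 0 ≤ χz x ∧ 0 ≤ χn x ∧ 0 ≤ χf x ∧ χz x + χn x + χf x ≤ 1)
    (hd : ∀ x, deriv χz x ^ 2 + deriv χn x ^ 2 + deriv χf x ^ 2 ≤ 16 / x ^ 2)
    (hoff : ∀ x, ¬(L < |x| ∧ |x| < Λ * L) → deriv χz x = 0 ∧ deriv χn x = 0 ∧ deriv χf x = 0) :
    (∫⁻ x, ENNReal.ofReal ((χz x * g x) ^ 2 + deriv (fun y => χz y * h y) x ^ 2 + V x * (χz x * h x) ^ 2))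
      + (∫⁻ x, ENNReal.ofReal ((χn x * g x) ^ 2 + deriv (fun y => χn y * h y) x ^ 2 + V x * (χn x * h x) ^ 2))
      + (∫⁻ x, ENNReal.ofReal ((χf x * g x) ^ 2 + deriv (fun y => χf y * h y) x ^ 2 + V x * (χf x * h x) ^ 2))
      ≤ (∫⁻ x, ENNReal.ofReal (g x ^ 2 + deriv h x ^ 2 + V x * h x ^ 2))
        + ∫⁻ x in {x : ℝ | L < |x| ∧ |x| < Λ * L},
            ENNReal.ofReal (2 * (g x ^ 2 + deriv h x ^ 2 + V x * h x ^ 2) + 32 * (h x ^ 2 / x ^ 2)) := by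
  have hhd : Differentiable ℝ h := hh.differentiable (by norm_num)
  set lay : Set ℝ := {x : ℝ | L < |x| ∧ |x| < Λ * L} with hlay
  set e0 : ℝ → ℝ := fun x => g x ^ 2 + deriv h x ^ 2 + V x * h x ^ 2 with he0
  set F : ℝ → ℝ := fun x => 2 * (g x ^ 2 + deriv h x ^ 2 + V x * h x ^ 2) + 32 * (h x ^ 2 / x ^ 2)
    with hF
  have he0n : ∀ x, 0 ≤ e0 x := fun x => by have := hV0 x; positivity
  have hFn : ∀ x, 0 ≤ F x := fun x => by have := hV0 x; positivity
  -- pointwise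
  have hpt : ∀ x,
      ENNReal.ofReal ((χz x * g x) ^ 2 + deriv (fun y => χz y * h y) x ^ 2 + V x * (χz x * h x) ^ 2)
        + ENNReal.ofReal ((χn x * g x) ^ 2 + deriv (fun y => χn y * h y) x ^ 2 + V x * (χn x * h x) ^ 2)
        + ENNReal.ofReal ((χf x * g x) ^ 2 + deriv (fun y => χf y * h y) x ^ 2 + V x * (χf x * h x) ^ 2)
      ≤ ENNReal.ofReal (e0 x) + lay.indicator (fun x => ENNReal.ofReal (F x)) x := by
    intro x
    obtain ⟨h0z, h0n, h0f, hs⟩ := h01 x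
    have hVx := hV0 x
    rw [deriv_fun_mul (hχz x) (hhd x), deriv_fun_mul (hχn x) (hhd x), deriv_fun_mul (hχf x) (hhd x),
      ← ENNReal.ofReal_add (by positivity) (by positivity),
      ← ENNReal.ofReal_add (by positivity) (by positivity)]
    by_cases hx : x ∈ lay
    · rw [indicator_of_mem hx, ← ENNReal.ofReal_add (he0n x) (hFn x)]
      refine ENNReal.ofReal_le_ofReal ?_
      have h1 := three_density_le (g := g x) (h := h x) (h' := deriv h x) hVx h0z h0n h0f hs (hd x)
      have h2 : deriv h x ^ 2 + 2 * (16 / x ^ 2) * h x ^ 2 ≤ F x := by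
        simp only [hF]
        have : 2 * (16 / x ^ 2) * h x ^ 2 = 32 * (h x ^ 2 / x ^ 2) := by ring
        rw [this]
        nlinarith [sq_nonneg (g x), mul_nonneg hVx (sq_nonneg (h x)), sq_nonneg (deriv h x)]
      simp only [he0]
      linarith
    · rw [indicator_of_notMem hx, add_zero]
      refine ENNReal.ofReal_le_ofReal ?_
      obtain ⟨dz, dn, df⟩ := hoff x hx
      rw [dz, dn, df]
      exact three_density_le_off (g := g x) (h := h x) (h' := deriv h x) hVx h0z h0n h0f hs
  calc _ ≤ ∫⁻ x, (ENNReal.ofReal ((χz x * g x) ^ 2 + deriv (fun y => χz y * h y) x ^ 2 + V x * (χz x * h x) ^ 2)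
        + ENNReal.ofReal ((χn x * g x) ^ 2 + deriv (fun y => χn y * h y) x ^ 2 + V x * (χn x * h x) ^ 2)
        + ENNReal.ofReal ((χf x * g x) ^ 2 + deriv (fun y => χf y * h y) x ^ 2 + V x * (χf x * h x) ^ 2)) := by
        refine le_trans ?_ (le_lintegral_add _ _)
        gcongr
        exact le_lintegral_add _ _
    _ ≤ ∫⁻ x, (ENNReal.ofReal (e0 x) + lay.indicator (fun x => ENNReal.ofReal (F x)) x) :=
        lintegral_mono hpt
    _ = (∫⁻ x, ENNReal.ofReal (e0 x)) + ∫⁻ x in lay, ENNReal.ofReal (F x) := by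
        rw [lintegral_add_left (measurable_dataDensity hV hh hg), lintegral_indicator (measurableSet_layer _ _)]

/-- **Energy of the gap piece**: `∫⁻ e(χg) ≤ ∫⁻_{layer} F`. [folklore] -/
theorem lintegral_gap_le (hV0 : ∀ x, 0 ≤ V x) (hh : Differentiable ℝ h) {χg : ℝ → ℝ}
    (hχg : Differentiable ℝ χg) (h0 : ∀ x, 0 ≤ χg x) (h1 : ∀ x, χg x ≤ 1)
    (hd : ∀ x, deriv χg x ^ 2 ≤ 16 / x ^ 2)
    (hoff : ∀ x, ¬(L < |x| ∧ |x| < Λ * L) → χg x = 0 ∧ deriv χg x = 0) :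
    (∫⁻ x, ENNReal.ofReal ((χg x * g x) ^ 2 + deriv (fun y => χg y * h y) x ^ 2 + V x * (χg x * h x) ^ 2))
      ≤ ∫⁻ x in {x : ℝ | L < |x| ∧ |x| < Λ * L},
          ENNReal.ofReal (2 * (g x ^ 2 + deriv h x ^ 2 + V x * h x ^ 2) + 32 * (h x ^ 2 / x ^ 2)) := by
  set lay : Set ℝ := {x : ℝ | L < |x| ∧ |x| < Λ * L} with hlay
  rw [← lintegral_indicator (measurableSet_layer _ _)]
  refine lintegral_mono fun x => ?_
  have hVx := hV0 x
  rw [deriv_fun_mul (hχg x) (hh x)]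
  by_cases hx : x ∈ lay
  · rw [indicator_of_mem hx]
    refine ENNReal.ofReal_le_ofReal ?_
    have h2 := gap_density_le (g := g x) (h := h x) (h' := deriv h x) hVx (h0 x) (h1 x) (hd x)
    have : 2 * (16 / x ^ 2) * h x ^ 2 = 32 * (h x ^ 2 / x ^ 2) := by ring
    rw [this] at h2
    nlinarith [sq_nonneg (g x), mul_nonneg hVx (sq_nonneg (h x)), sq_nonneg (deriv h x)]
  · rw [indicator_of_notMem hx]
    obtain ⟨c0, d0⟩ := hoff x hx
    rw [c0, d0]
    simp

/-! ### The pigeonhole over geometric layers -/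

/-- `∫⁻_ℝ F ≤ 130 ∫⁻ e₀` for data vanishing on `[−ρ, ρ]` (two-sided Hardy). [folklore] -/
theorem lintegral_cost_le (hV : Continuous V) (hV0 : ∀ x, 0 ≤ V x) (hh : ContDiff ℝ 1 h)
    (hg : Continuous g) {ρ : ℝ} (hρ : 0 < ρ) (h0 : ∀ x, |x| ≤ ρ → h x = 0) :
    (∫⁻ x, ENNReal.ofReal (2 * (g x ^ 2 + deriv h x ^ 2 + V x * h x ^ 2) + 32 * (h x ^ 2 / x ^ 2)))
      ≤ 130 * ∫⁻ x, ENNReal.ofReal (g x ^ 2 + deriv h x ^ 2 + V x * h x ^ 2) := by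
  have hmeas := measurable_dataDensity hV hh hg
  have hH := lintegral_sq_div_sq_le_four_mul hh hρ h0
  have hder : (∫⁻ x, ENNReal.ofReal (deriv h x ^ 2))
      ≤ ∫⁻ x, ENNReal.ofReal (g x ^ 2 + deriv h x ^ 2 + V x * h x ^ 2) := by
    refine lintegral_mono fun x => ENNReal.ofReal_le_ofReal ?_
    nlinarith [sq_nonneg (g x), mul_nonneg (hV0 x) (sq_nonneg (h x))]
  calc (∫⁻ x, ENNReal.ofReal (2 * (g x ^ 2 + deriv h x ^ 2 + V x * h x ^ 2) + 32 * (h x ^ 2 / x ^ 2)))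
      = ∫⁻ x, (2 * ENNReal.ofReal (g x ^ 2 + deriv h x ^ 2 + V x * h x ^ 2)
          + 32 * ENNReal.ofReal (h x ^ 2 / x ^ 2)) := by
        refine lintegral_congr fun x => ?_
        have := hV0 x
        rw [ENNReal.ofReal_add (by positivity) (by positivity), ENNReal.ofReal_mul (by norm_num),
          ENNReal.ofReal_mul (by norm_num), ENNReal.ofReal_ofNat, ENNReal.ofReal_ofNat]
    _ = 2 * (∫⁻ x, ENNReal.ofReal (g x ^ 2 + deriv h x ^ 2 + V x * h x ^ 2))
          + 32 * ∫⁻ x, ENNReal.ofReal (h x ^ 2 / x ^ 2) := by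
        rw [lintegral_add_left (hmeas.const_mul 2), lintegral_const_mul' _ _ (by simp),
          lintegral_const_mul' _ _ (by simp)]
    _ ≤ 2 * (∫⁻ x, ENNReal.ofReal (g x ^ 2 + deriv h x ^ 2 + V x * h x ^ 2))
          + 32 * (4 * ∫⁻ x, ENNReal.ofReal (g x ^ 2 + deriv h x ^ 2 + V x * h x ^ 2)) := by
        gcongr
        exact hH.trans (by gcongr)
    _ = 130 * ∫⁻ x, ENNReal.ofReal (g x ^ 2 + deriv h x ^ 2 + V x * h x ^ 2) := by ring

end Integrated

end LayerSplit

open LayerSplit in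
/-- **The cheap layer** (registered principal fact of this support file; stub `stub_layerSplit`,
line `Sketch`).  For a continuous potential `V ≥ 0`, data `h ∈ C¹` vanishing on `[−ρ, ρ]` (`ρ > 0`)
and `g ∈ C⁰`, a ratio `Λ ≥ 1`, a base scale `Rs > 0` and `N ≥ 1` layers, one of the geometric
layers `{RsΛ^j < |x| < RsΛ^{j+1}}`, `j < N`, has layer cost
`N · ∫⁻_{layer j} (2e₀ + 32h²/x²) ≤ 130 ∫⁻ e₀`, `e₀ = g² + h′² + Vh²`. [folklore] -/
theorem layerSplit_exists_cheap_layer : ∀ (V h g : ℝ → ℝ), Continuous V → (∀ x, 0 ≤ V x) →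
    ContDiff ℝ 1 h → Continuous g → ∀ ρ : ℝ, 0 < ρ → (∀ x, |x| ≤ ρ → h x = 0) →
    ∀ Λ : ℝ, 1 ≤ Λ → ∀ Rs : ℝ, 0 < Rs → ∀ N : ℕ, 1 ≤ N →
    ∃ j : ℕ, j < N ∧ (N : ENNReal) * (∫⁻ x in {x : ℝ | Rs * Λ ^ j < |x| ∧ |x| < Λ * (Rs * Λ ^ j)},
        ENNReal.ofReal (2 * (g x ^ 2 + deriv h x ^ 2 + V x * h x ^ 2) + 32 * (h x ^ 2 / x ^ 2)))
      ≤ 130 * ∫⁻ x, ENNReal.ofReal (g x ^ 2 + deriv h x ^ 2 + V x * h x ^ 2) := by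
  intro V h g hV hV0 hh hg ρ hρ h0 Λ hΛ Rs hRs N hN
  set F : ℝ → ℝ≥0∞ := fun x =>
    ENNReal.ofReal (2 * (g x ^ 2 + deriv h x ^ 2 + V x * h x ^ 2) + 32 * (h x ^ 2 / x ^ 2)) with hF
  set lay : ℕ → Set ℝ := fun j => {x : ℝ | Rs * Λ ^ j < |x| ∧ |x| < Λ * (Rs * Λ ^ j)} with hlay
  set c : ℕ → ℝ≥0∞ := fun j => ∫⁻ x in lay j, F x with hc
  obtain ⟨j, hj, hmin⟩ := Finset.exists_min_image (Finset.range N) c ⟨0, by simp; omega⟩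
  refine ⟨j, Finset.mem_range.1 hj, ?_⟩
  -- disjointness of the layers
  have hmono : ∀ i k : ℕ, i < k → Λ * (Rs * Λ ^ i) ≤ Rs * Λ ^ k := by
    intro i k hik
    rw [mul_comm, mul_assoc, ← pow_succ]
    exact mul_le_mul_of_nonneg_left (pow_le_pow_right₀ hΛ (Nat.succ_le_of_lt hik)) hRs.le
  have hdisj : Set.PairwiseDisjoint (↑(Finset.range N) : Set ℕ) lay := by
    intro i _ k _ hik
    rw [Function.onFun, Set.disjoint_left]
    intro x hxi hxk
    rcases lt_or_gt_of_ne hik with hlt | hlt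
    · have := hmono i k hlt
      exact absurd (lt_trans hxk.1 hxi.2) (not_lt.2 this)
    · have := hmono k i hlt
      exact absurd (lt_trans hxi.1 hxk.2) (not_lt.2 this)
  have hsum : ∑ i ∈ Finset.range N, c i ≤ ∫⁻ x, F x := by
    rw [← lintegral_biUnion_finset hdisj (fun b _ => measurableSet_layer _ _)]
    exact setLIntegral_le_lintegral _ _
  calc (N : ℝ≥0∞) * c j = ∑ _i ∈ Finset.range N, c j := by
        rw [Finset.sum_const, Finset.card_range, nsmul_eq_mul]
    _ ≤ ∑ i ∈ Finset.range N, c i := Finset.sum_le_sum hmin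
    _ ≤ ∫⁻ x, F x := hsum
    _ ≤ 130 * ∫⁻ x, ENNReal.ofReal (g x ^ 2 + deriv h x ^ 2 + V x * h x ^ 2) :=
        lintegral_cost_le hV hV0 hh hg hρ h0

end Summit.FinalStateConjecture.FinalStateConjecture.Theorems.WindowedShellChannelsSketch

end
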